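import Summits.HubbardSuperconductivity.HubbardSuperconductivity.Theorems.SoloBlindTwistAveraging
import HarnessLib

/-!
# An explicit certificate multiplier from the sector gap

Companion to `SoloBlindCertificateForm` (`hubbardSuperconductivity_iff_certificate`: the summit is
equivalent to one positive-semidefiniteness certificate
`c L⁴ ≤ re ⟨φ, Δ_d†Δ_d φ⟩ + κ_L (re ⟨φ, H φ⟩ - E₀)` on the unit vectors of the doped sector per large
even side, and `multiplier_mul_twistEnergy_ge`: necessarily `κ_L ≥ c L⁴ / (16π²|t| (M²+M))`). Here
the converse direction is made QUANTITATIVE: the multiplier never needs to exceed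
`(400 L⁴ + a/2) / γ`, where `γ` is the gap of `H` above its ground multiplet inside the sector and
`a` the order carried by the ground multiplet.

* `half_re_self_sub_le_re_add_self` — `‖x‖²/2 - ‖y‖² ≤ ‖x + y‖²` for the Hermitian form on `n → ℂ`.
* `certificate_of_orthogonal_split` (abstract) — if `φ = u + w` with `re ⟨u, w⟩ = 0`,
  `‖A u‖² ≥ a ‖u‖²` (order on the ground component), `‖A w‖² ≤ B ‖w‖²` (operator bound) and
  `γ ‖w‖² ≤ G` (gap: `G` = the energy of `φ` above `E₀`), then
  `(a/2) ‖φ‖² ≤ ‖A φ‖² + ((B + a/2)/γ) · G`.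
* `pairField_order_le` — `re ⟨Δ_g ψ, Δ_g ψ⟩ ≤ 400 L⁴ ‖ψ‖²` for `|g| ≤ 1` (the `m = 0` term of
  `sum_twist_pairField_order_le`).
* `certificate_multiplier_of_sectorGap` — for the Hubbard torus `H = hubbardTorus 2 L t U`, any set
  of states `S`, any "ground projection" `P` (only three properties are used: `re ⟨Pφ, φ - Pφ⟩ = 0`,
  order `a` on `P φ`, and the gap inequality `γ ‖φ - Pφ‖² ≤ re ⟨φ, Hφ⟩ - E₀ ‖φ‖²` on `S`):
  every `φ ∈ S` satisfies the certificate
  `(a/2) ‖φ‖² ≤ re ⟨Δ_g φ, Δ_g φ⟩ + ((400 L⁴ + a/2)/γ) (re ⟨φ, Hφ⟩ - E₀ ‖φ‖²)`.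
  With `P` the orthogonal projection onto the ground eigenspace of `H` in the `(N, S^z)` sector,
  `E₀` the sector ground energy and `γ` the gap to the next eigenvalue in the sector, the three
  properties hold (spectral theorem), so: GROUND-STATE ORDER `a = c L⁴` IS CERTIFIED WITH MULTIPLIER
  `κ_L = (400 + c/2) L⁴ / γ_L`. Together with the necessary `κ_L ≳ c L⁴/|t|` this pins the cost of a
  certificate to the inverse sector gap `1/γ_L` — the gap above the ground multiplet to the first
  excited level of the sector WHATEVER ITS NATURE (a phase mode at `~ |t|/L`, or a quasi-degenerate
  competing state at an exponentially small splitting).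

References: standard linear algebra; the operator bound is this seat's `sum_twist_pairField_order_le`.
-/

namespace Summit.HubbardSuperconductivity.HubbardSuperconductivity.Theorems

open Matrix Finset Literature.MathematicalPhysics.QuantumLattice
  Literature.MathematicalPhysics.QuantumFieldTheory GaugeTwist
open scoped ComplexConjugate ComplexOrder

section Abstract

variable {n : Type*} [Fintype n]

/-- `‖x‖²/2 - ‖y‖² ≤ ‖x + y‖²` for the standard Hermitian form on `n → ℂ`. [folklore] -/
theorem half_re_self_sub_le_re_add_self (x y : n → ℂ) :
    (star x ⬝ᵥ x).re / 2 - (star y ⬝ᵥ y).re ≤ (star (x + y) ⬝ᵥ (x + y)).re := by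
  rw [← norm_toLp_sq_eq_re, ← norm_toLp_sq_eq_re, ← norm_toLp_sq_eq_re, WithLp.toLp_add]
  set a := (WithLp.toLp 2 x : EuclideanSpace ℂ n)
  set b := (WithLp.toLp 2 y : EuclideanSpace ℂ n)
  have h : ‖a‖ ≤ ‖a + b‖ + ‖b‖ := by
    calc ‖a‖ = ‖(a + b) - b‖ := by rw [add_sub_cancel_right]
      _ ≤ ‖a + b‖ + ‖b‖ := norm_sub_le _ _
  nlinarith [h, norm_nonneg a, norm_nonneg b, norm_nonneg (a + b), sq_nonneg (‖a + b‖ - ‖b‖),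
    mul_nonneg (norm_nonneg a) (sub_nonneg.2 h)]

/-- `‖u + w‖² = ‖u‖² + ‖w‖²` when `re ⟨u, w⟩ = 0`. [folklore] -/
theorem re_add_self_of_orthogonal (u w : n → ℂ) (horth : (star u ⬝ᵥ w).re = 0) :
    (star (u + w) ⬝ᵥ (u + w)).re = (star u ⬝ᵥ u).re + (star w ⬝ᵥ w).re := by
  have h : star u ⬝ᵥ w = star (star w ⬝ᵥ u) := by
    rw [← star_dotProduct_star, star_star]
  have hcomm : (star w ⬝ᵥ u).re = (star u ⬝ᵥ w).re := by
    rw [h, Complex.star_def, Complex.conj_re]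
  rw [star_add, add_dotProduct, dotProduct_add, dotProduct_add, Complex.add_re, Complex.add_re,
    Complex.add_re, hcomm, horth]
  ring

/-- **Certificate step** (abstract): order `a` on the ground component `u`, operator bound `B` on
the excited component `w`, gap `γ ‖w‖² ≤ G`; then `(a/2)‖u+w‖² ≤ ‖A(u+w)‖² + ((B + a/2)/γ) G`.
[this work] -/
theorem certificate_of_orthogonal_split (A : Matrix n n ℂ) (u w : n → ℂ) (a B γ G : ℝ)
    (hγ : 0 < γ) (hBa : 0 ≤ B + a / 2) (horth : (star u ⬝ᵥ w).re = 0)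
    (hord : a * (star u ⬝ᵥ u).re ≤ (star (A *ᵥ u) ⬝ᵥ (A *ᵥ u)).re)
    (hB : (star (A *ᵥ w) ⬝ᵥ (A *ᵥ w)).re ≤ B * (star w ⬝ᵥ w).re)
    (hgap : γ * (star w ⬝ᵥ w).re ≤ G) :
    a / 2 * (star (u + w) ⬝ᵥ (u + w)).re ≤
      (star (A *ᵥ (u + w)) ⬝ᵥ (A *ᵥ (u + w))).re + (B + a / 2) / γ * G := by
  have h1 := half_re_self_sub_le_re_add_self (A *ᵥ u) (A *ᵥ w)
  rw [← mulVec_add] at h1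
  have h2 : (B + a / 2) * (star w ⬝ᵥ w).re ≤ (B + a / 2) / γ * G := by
    have := mul_le_mul_of_nonneg_left hgap (div_nonneg hBa hγ.le)
    calc (B + a / 2) * (star w ⬝ᵥ w).re = (B + a / 2) / γ * (γ * (star w ⬝ᵥ w).re) := by
          field_simp
      _ ≤ (B + a / 2) / γ * G := this
  rw [re_add_self_of_orthogonal u w horth]
  linarith

end Abstract

section Hubbard

-- `FermionTorus 2 L = Lex (Fin 2 → Fin L)`: the terms landed in the Literature and in
-- `SoloBlindGaugeTwist` carry `DecidableEq (FermionTorus 2 L)` through the LINEAR ORDER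
-- (`LinearOrder.toDecidableEq`), whereas instance synthesis now prefers Mathlib's generic
-- `instDecidableEqLex` (not reducibly defeq to it), so `rw [diagonal_conjTranspose, mulVec_diagonal]`
-- fails with "synthesized type class instance is not definitionally equal". Switching the generic
-- instance off FOR THIS FILE ONLY makes synthesis agree with the landed terms; no instance is added,
-- and every statement below is instance-free at the level of its hypotheses and conclusions.
attribute [-instance] instDecidableEqLex

variable {L : ℕ} [NeZero L]

/-- The untwisted copy: `W_0ᴴ ψ = ψ`. [folklore] -/
theorem twistOp_zero_conjTranspose_mulVec (ψ : Fock (Orb (FermionTorus 2 L))) :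
    (twistOp (0 : ZMod L))ᴴ *ᵥ ψ = ψ := by
  ext S
  unfold twistOp
  rw [phaseGauge_eq, diagonal_conjTranspose, mulVec_diagonal]
  simp [twistChar]

/-- **Operator bound**: `re ⟨Δ_g ψ, Δ_g ψ⟩ ≤ 400 L⁴ ‖ψ‖²` for `|g| ≤ 1`. [folklore] -/
theorem pairField_order_le (g : (Fin 2 → ℤ) → ℝ) (hg : ∀ e, |g e| ≤ 1)
    (ψ : Fock (Orb (FermionTorus 2 L))) :
    (star (pairField g L *ᵥ ψ) ⬝ᵥ (pairField g L *ᵥ ψ)).re ≤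
      400 * (L : ℝ) ^ 4 * (star ψ ⬝ᵥ ψ).re := by
  have hsum := sum_twist_pairField_order_le g hg ψ
  have hle : (star (pairField g L *ᵥ ((twistOp (0 : ZMod L))ᴴ *ᵥ ψ)) ⬝ᵥ
        (pairField g L *ᵥ ((twistOp (0 : ZMod L))ᴴ *ᵥ ψ))).re ≤
      ∑ m : ZMod L, (star (pairField g L *ᵥ ((twistOp m)ᴴ *ᵥ ψ)) ⬝ᵥ
        (pairField g L *ᵥ ((twistOp m)ᴴ *ᵥ ψ))).re :=
    Finset.single_le_sum (f := fun m : ZMod L => (star (pairField g L *ᵥ ((twistOp m)ᴴ *ᵥ ψ)) ⬝ᵥ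
        (pairField g L *ᵥ ((twistOp m)ᴴ *ᵥ ψ))).re)
      (fun m _ => (Complex.nonneg_iff.mp (dotProduct_star_self_nonneg _)).1) (Finset.mem_univ 0)
  rw [twistOp_zero_conjTranspose_mulVec] at hle
  exact hle.trans hsum

/-- **Explicit certificate multiplier from the sector gap** (Hubbard torus, any hopping `t`,
coupling `U`, form factor `|g| ≤ 1`, reference energy `E₀`, set of states `S`, and any matrix `P`
with the three listed properties on `S` — e.g. the orthogonal projection onto the ground eigenspace
of `H` in an `(N, S^z)` sector, `E₀` the sector ground energy, `γ` the gap to the next level):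
order `a` on the range of `P` is certified on all of `S` with multiplier `(400 L⁴ + a/2)/γ`.
[this work] -/
theorem certificate_multiplier_of_sectorGap (t U E₀ a γ : ℝ) (hγ : 0 < γ) (ha : 0 ≤ a)
    (g : (Fin 2 → ℤ) → ℝ) (hg : ∀ e, |g e| ≤ 1)
    (S : Set (Fock (Orb (FermionTorus 2 L))))
    (P : Matrix (Finset (Orb (FermionTorus 2 L))) (Finset (Orb (FermionTorus 2 L))) ℂ)
    (horth : ∀ φ ∈ S, (star (P *ᵥ φ) ⬝ᵥ (φ - P *ᵥ φ)).re = 0)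
    (hord : ∀ φ ∈ S, a * (star (P *ᵥ φ) ⬝ᵥ (P *ᵥ φ)).re ≤
      (star (pairField g L *ᵥ (P *ᵥ φ)) ⬝ᵥ (pairField g L *ᵥ (P *ᵥ φ))).re)
    (hgap : ∀ φ ∈ S, γ * (star (φ - P *ᵥ φ) ⬝ᵥ (φ - P *ᵥ φ)).re ≤
      (star φ ⬝ᵥ (hubbardTorus 2 L t U *ᵥ φ)).re - E₀ * (star φ ⬝ᵥ φ).re) :
    ∀ φ ∈ S, a / 2 * (star φ ⬝ᵥ φ).re ≤
      (star (pairField g L *ᵥ φ) ⬝ᵥ (pairField g L *ᵥ φ)).re +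
        (400 * (L : ℝ) ^ 4 + a / 2) / γ *
          ((star φ ⬝ᵥ (hubbardTorus 2 L t U *ᵥ φ)).re - E₀ * (star φ ⬝ᵥ φ).re) := by
  intro φ hφ
  have h := certificate_of_orthogonal_split (pairField g L) (P *ᵥ φ) (φ - P *ᵥ φ) a
    (400 * (L : ℝ) ^ 4) γ _ hγ (by positivity) (horth φ hφ) (hord φ hφ)
    (pairField_order_le g hg _) (hgap φ hφ)
  rwa [add_sub_cancel] at h

end Hubbard

end Summit.HubbardSuperconductivity.HubbardSuperconductivity.Theorems
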